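/-
Copyright: b2b-lace packet (enumeration shard A, gen 10).  A second, cheaper kernel recursion for the SAW
end-point counts of `SawCountKernel`/`SawCountTables`: same numbers, same transfer theorem, about a third of
the kernel work per class.  No cell of the record is touched; no fact; no `sorry`.
-/
import Literature.Probability.FitznerVanDerHofstad2017.SawCountTables
import HarnessLib

/-!
# The kernel recursion `sawCodeG`: the coded SAW recursion with its last two levels in closed form

CITATION HEADER (PLACEMENT v2). This module is part of a certified REPRODUCTION of:
R. Fitzner, R. van der Hofstad, *Mean-field behavior for nearest-neighbor percolation in d > 10*,
Electron. J. Probab. 22 (2017), no. 43 [FvdH17]; *Generalized approach to the non-backtracking lace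
expansion*, Probab. Theory Related Fields 169 (2017) [NoBLE17-I] (arXiv:1506.07977, 1506.07969).
Reproduces: the notebook input `nrSAW[n,d,x]` (SRW.nb §3: "number of n-step SAWs from 0 to x", polynomials
in `d`).  Here: a faster MACHINE for the same numbers (`SawCountKernel` is the reference machine).

## What changes with respect to `sawCodeF`

`sawCodeG n j m c l1 V L` runs the recursion of `SawCountKernel.sawCodeF` (codes `c`, carried `‖y‖₁ = l1`,
`m` active coordinates, `j` fresh coordinates owed, visited list `L` with residue filter `V`) with four
kernel-side economies, none of which changes a value on the states that the transfer theorem visits: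
* the walk never revisits the origin, so a state with `‖y‖₁ = 0` and steps left is worth `0`
  (`sawCount_eq_zero_of_zero_mem`);
* TWO steps before the end the count is read off directly: from `y` with `‖y‖₁ = 2` the number of two-step
  self-avoiding completions is the number of inward neighbours of `y` not yet visited (`sawCount_one_eq`,
  the case `n = 1` of the transfer theorem) — this removes the two most populated levels of the recursion tree;
* no parity test (parity of `n + ‖y‖₁` is invariant along the recursion, and odd states die at the leaf);
* primitive `Nat.add/sub/mul/div/mod/blt/ble/beq/land/lor/shiftRight/pow`, the bare recursor `Nat.rec`, and the
  digits of `c` read off a running quotient.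
The TRANSFER THEOREM **`sawCount_eq_sum_sawCodeG`** is `SawCountKernel.sawCount_eq_sum_sawCode` for the new
machine (same statement plus the hypothesis `0 ∉ A`, vacuous at the root), whence
**`card_sawWordsTo_siteOfList_G`**: `#sawWordsTo d n x = Σ_{j ≤ n} sawCodeG n j s C L1 0 [] · 2^j (d-s)^{(j)}`,
each coefficient one `decide +kernel`, uniformly in `d ≥ s`.  The one-step expansion `sawCodeG_succ_expand`
(children `gPlus`/`gMinus`/`gFresh`, cf. `SawCountTables.sawCodeF_succ_expand`) splits evaluations that are
too large for one kernel call.  Measured on the farm: `≈ 1.0·10⁻⁴ s` per node of the `sawCodeF` tree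
(`sawCodeF`: `≈ 4·10⁻⁴ s`).

## What is NOT here

No numeral table, no dimension fixed, no cell, no fact, no `sorry`.

## References
* N. Madras, G. Slade, The Self-Avoiding Walk (1993), §1.1–1.2 [folklore recursion].
* R. Fitzner, R. van der Hofstad, SRW.nb (2015) §3, arXiv:1506.07977 anc. (the table reproduced downstream).
-/

namespace Literature.Probability.FitznerVanDerHofstad2017

open Finset Literature.Probability.LatticeModels Literature.Probability.Percolation

variable {d : ℕ}

/-! ### The recursion `sawCodeG` (kernel side: `ℕ`, `Bool`, `List ℕ`, primitive operations) -/

/-- Filtered membership with primitive operations (`= memF`, lemma `memG_eq`). [folklore] -/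
def memG (c V : ℕ) (L : List ℕ) : Bool :=
  bif Nat.beq (Nat.land (Nat.shiftRight V (Nat.mod c 4093)) 1) 1 then memL c L else false

/-- Zero steps left (cf. `sawBaseF`). [folklore] -/
def sawBaseG (j _m c l1 V : ℕ) (L : List ℕ) : ℕ :=
  bif Nat.beq (Nat.add j l1) 0 then (bif memG c V L then 0 else 1) else 0

/-- Two steps left, at `‖y‖₁ = 2`: the contribution of coordinate `i` (digit `g`, place value `p`) — its
inward neighbour, if not yet visited. [folklore] -/
def leafTermG (c V' : ℕ) (L' : List ℕ) (g p : ℕ) : ℕ :=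
  Nat.add (bif Nat.blt g 32 then (bif memG (Nat.add c p) V' L' then 0 else 1) else 0)
    (bif Nat.blt 32 g then (bif memG (Nat.sub c p) V' L' then 0 else 1) else 0)

/-- Two steps left: the loop over the active coordinates (`q` = remaining digits, `p` = place value,
`acc` = accumulator). [folklore] -/
noncomputable def leafLoopG (c V' : ℕ) (L' : List ℕ) : ℕ → ℕ → ℕ → ℕ → ℕ :=
  Nat.rec (motive := fun _ => ℕ → ℕ → ℕ → ℕ) (fun _ _ acc => acc)
    (fun _ ih q p acc => ih (Nat.div q 64) (Nat.mul p 64) (Nat.add acc (leafTermG c V' L' (Nat.mod q 64) p)))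

/-- General step: the `+e_i` child (digit `g`, place value `p`), spawned unless still-born. [folklore] -/
def plusTermG (rec : ℕ → ℕ → ℕ → ℕ → ℕ → List ℕ → ℕ) (j m c l1 V' : ℕ) (L' : List ℕ) (away : Bool)
    (g p : ℕ) : ℕ :=
  bif (away || Nat.blt g 32) then
    rec j m (Nat.add c p) (bif Nat.ble 32 g then Nat.add l1 1 else Nat.sub l1 1) V' L' else 0

/-- General step: the `-e_i` child (digit `g`, place value `p`), spawned unless still-born. [folklore] -/
def minusTermG (rec : ℕ → ℕ → ℕ → ℕ → ℕ → List ℕ → ℕ) (j m c l1 V' : ℕ) (L' : List ℕ) (away : Bool)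
    (g p : ℕ) : ℕ :=
  bif (away || Nat.blt 32 g) then
    rec j m (Nat.sub c p) (bif Nat.ble g 32 then Nat.add l1 1 else Nat.sub l1 1) V' L' else 0

/-- General step: the loop over the active coordinates. [folklore] -/
noncomputable def stepLoopG (rec : ℕ → ℕ → ℕ → ℕ → ℕ → List ℕ → ℕ) (j m c l1 V' : ℕ) (L' : List ℕ)
    (away : Bool) : ℕ → ℕ → ℕ → ℕ → ℕ :=
  Nat.rec (motive := fun _ => ℕ → ℕ → ℕ → ℕ) (fun _ _ acc => acc)
    (fun _ ih q p acc => ih (Nat.div q 64) (Nat.mul p 64)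
      (Nat.add (Nat.add acc (plusTermG rec j m c l1 V' L' away (Nat.mod q 64) p))
        (minusTermG rec j m c l1 V' L' away (Nat.mod q 64) p)))

/-- General step: the fresh child (coordinate `m`, entered upwards), if a fresh coordinate is owed. [folklore] -/
def freshTermG (rec : ℕ → ℕ → ℕ → ℕ → ℕ → List ℕ → ℕ) (j m c l1 V' : ℕ) (L' : List ℕ) : ℕ :=
  bif Nat.beq j 0 then 0 else rec (Nat.sub j 1) (Nat.add m 1) (Nat.add c (Nat.pow 64 m)) (Nat.add l1 1) V' L'

/-- One step of `sawCodeG` (`n + 1` steps left): prune (`n + 1 < 2j + l1`), visited, at the origin too early;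
then for `n + 1 = 2` the closed form, else the children. [folklore] -/
noncomputable def sawStepG (n : ℕ) (rec : ℕ → ℕ → ℕ → ℕ → ℕ → List ℕ → ℕ) (j m c l1 V : ℕ) (L : List ℕ) : ℕ :=
  bif Nat.blt (Nat.add n 1) (Nat.add (Nat.mul 2 j) l1) then 0 else
  bif memG c V L then 0 else
  bif Nat.beq l1 0 then 0 else
  bif Nat.beq n 1 then
    (bif Nat.beq l1 2 then leafLoopG c (Nat.lor V (Nat.pow 2 (Nat.mod c 4093))) (c :: L) m c 1 0 else 0)
  else
    Nat.add
      (stepLoopG rec j m c l1 (Nat.lor V (Nat.pow 2 (Nat.mod c 4093))) (c :: L)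
        (Nat.ble (Nat.add (Nat.add (Nat.mul 2 j) l1) 2) (Nat.add n 1)) m c 1 0)
      (freshTermG rec j m c l1 (Nat.lor V (Nat.pow 2 (Nat.mod c 4093))) (c :: L))

/-- **The kernel recursion `sawCodeG`** (by the bare recursor; what the kernel runs in the `SawCountTablesG*`
files). [folklore] -/
noncomputable def sawCodeG : ℕ → ℕ → ℕ → ℕ → ℕ → ℕ → List ℕ → ℕ :=
  Nat.rec (motive := fun _ => ℕ → ℕ → ℕ → ℕ → ℕ → List ℕ → ℕ) sawBaseG fun n rec => sawStepG n rec

/-! ### Unfolding lemmas -/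

/-- `memG = memF`. [folklore] -/
theorem memG_eq (c V : ℕ) (L : List ℕ) : memG c V L = memF c V L := by
  have h1 : Nat.beq (Nat.land (Nat.shiftRight V (Nat.mod c 4093)) 1) 1 = Nat.testBit V (c % sawP) := by
    rw [Nat.testBit_eq_decide_div_mod_eq, natBeq_eq_decide]
    show decide ((V >>> (c % 4093)) &&& 1 = 1) = _
    rw [Nat.shiftRight_eq_div_pow, Nat.and_one_is_mod]
    rfl
  unfold memG memF
  rw [h1]
  cases Nat.testBit V (c % sawP) <;> rfl

/-- `sawCodeG 0 = sawBaseG`. [folklore] -/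
theorem sawCodeG_zero : sawCodeG 0 = sawBaseG := rfl

/-- `sawCodeG (n+1) = sawStepG n (sawCodeG n)`. [folklore] -/
theorem sawCodeG_succ (n : ℕ) : sawCodeG (n + 1) = sawStepG n (sawCodeG n) := rfl

/-- The leaf loop in closed form. [folklore] -/
theorem leafLoopG_eq (c V' : ℕ) (L' : List ℕ) (k : ℕ) :
    ∀ q p acc, leafLoopG c V' L' k q p acc =
      acc + ∑ i ∈ range k, leafTermG c V' L' (q / 64 ^ i % 64) (p * 64 ^ i) := by
  induction k with
  | zero => intro q p acc; simp [leafLoopG]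
  | succ k ih =>
    intro q p acc
    show leafLoopG c V' L' k (q / 64) (p * 64) (acc + leafTermG c V' L' (q % 64) p) = _
    rw [ih, sum_range_succ', add_assoc, add_comm (∑ i ∈ range k, _)]
    congr 2
    · simp
    · refine sum_congr rfl fun i _ => ?_
      rw [Nat.div_div_eq_div_mul, mul_assoc, ← pow_succ']

/-- The step loop in closed form. [folklore] -/
theorem stepLoopG_eq (rec : ℕ → ℕ → ℕ → ℕ → ℕ → List ℕ → ℕ) (j m c l1 V' : ℕ) (L' : List ℕ)
    (away : Bool) (k : ℕ) :
    ∀ q p acc, stepLoopG rec j m c l1 V' L' away k q p acc =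
      acc + ∑ i ∈ range k, (plusTermG rec j m c l1 V' L' away (q / 64 ^ i % 64) (p * 64 ^ i) +
        minusTermG rec j m c l1 V' L' away (q / 64 ^ i % 64) (p * 64 ^ i)) := by
  induction k with
  | zero => intro q p acc; simp [stepLoopG]
  | succ k ih =>
    intro q p acc
    show stepLoopG rec j m c l1 V' L' away k (q / 64) (p * 64)
      (acc + plusTermG rec j m c l1 V' L' away (q % 64) p + minusTermG rec j m c l1 V' L' away (q % 64) p) = _
    rw [ih, sum_range_succ', add_assoc acc, add_assoc, add_comm (∑ i ∈ range k, _)]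
    congr 2
    · simp
    · refine sum_congr rfl fun i _ => ?_
      rw [Nat.div_div_eq_div_mul, mul_assoc, ← pow_succ']

/-- A visited code is worth `0`. [folklore] -/
theorem sawCodeG_of_memF {n j m c l1 V : ℕ} {L : List ℕ} (h : memF c V L = true) :
    sawCodeG n j m c l1 V L = 0 := by
  cases n with
  | zero =>
    show sawBaseG j m c l1 V L = 0
    simp only [sawBaseG, memG_eq, h, cond_true]
    cases Nat.beq (Nat.add j l1) 0 <;> rfl
  | succ n =>
    show sawStepG n (sawCodeG n) j m c l1 V L = 0
    simp only [sawStepG, memG_eq, h, cond_true]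
    cases Nat.blt (Nat.add n 1) (Nat.add (Nat.mul 2 j) l1) <;> rfl

/-- The distance prune is sound on ALL inputs: `sawCodeG n j m c l1 V L = 0` if `n < 2j + l1`. [folklore] -/
theorem sawCodeG_prune {n j m c l1 V : ℕ} {L : List ℕ} (h : n < 2 * j + l1) : sawCodeG n j m c l1 V L = 0 := by
  cases n with
  | zero =>
    show sawBaseG j m c l1 V L = 0
    have : Nat.beq (Nat.add j l1) 0 = false := by rw [natBeq_eq_decide]; exact decide_eq_false (by show ¬ j + l1 = 0; omega)
    simp only [sawBaseG, this, cond_false]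
  | succ n =>
    show sawStepG n (sawCodeG n) j m c l1 V L = 0
    have : Nat.blt (Nat.add n 1) (Nat.add (Nat.mul 2 j) l1) = true := by
      rw [natBlt_eq_decide]; exact decide_eq_true (by show n + 1 < 2 * j + l1; omega)
    simp only [sawStepG, this, cond_true]

/-- At the origin with steps left: `0`. [folklore] -/
theorem sawCodeG_succ_origin (n j m c V : ℕ) (L : List ℕ) : sawCodeG (n + 1) j m c 0 V L = 0 := by
  show sawStepG n (sawCodeG n) j m c 0 V L = 0
  simp only [sawStepG]
  cases Nat.blt (Nat.add n 1) (Nat.add (Nat.mul 2 j) 0) <;> cases memG c V L <;> rfl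

/-- The zero-step value off the visited set. [folklore] -/
theorem sawCodeG_zero_of_not_memF {j m c l1 V : ℕ} {L : List ℕ} (h : memF c V L = false) :
    sawCodeG 0 j m c l1 V L = if j + l1 = 0 then 1 else 0 := by
  show sawBaseG j m c l1 V L = _
  simp only [sawBaseG, memG_eq, h, cond_false, natBeq_eq_decide, Bool.cond_decide]
  rfl

/-- **Generic one-step expansion** (`n + 1 ≠ 2` steps left, node alive): the unguarded sum over the `2m`
active children and the fresh child — a still-born child is worth `0` by the prune anyway. [folklore] -/
theorem sawCodeG_succ_of_open (n : ℕ) {j m c l1 V : ℕ} {L : List ℕ} (hn : n ≠ 1) (h : memF c V L = false)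
    (hp : ¬ n + 1 < 2 * j + l1) (h0 : l1 ≠ 0) :
    sawCodeG (n + 1) j m c l1 V L =
      (∑ i ∈ range m,
        (sawCodeG n j m (c + sawB ^ i) (if sawR ≤ digitAt c i then l1 + 1 else l1 - 1) (nextV c V) (c :: L) +
          sawCodeG n j m (c - sawB ^ i) (if digitAt c i ≤ sawR then l1 + 1 else l1 - 1) (nextV c V) (c :: L))) +
      (if j = 0 then 0 else sawCodeG n (j - 1) (m + 1) (c + sawB ^ m) (l1 + 1) (nextV c V) (c :: L)) := by
  have hb1 : Nat.blt (Nat.add n 1) (Nat.add (Nat.mul 2 j) l1) = false := by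
    rw [natBlt_eq_decide]; exact decide_eq_false (by show ¬ n + 1 < 2 * j + l1; omega)
  have hb2 : Nat.beq l1 0 = false := by rw [natBeq_eq_decide]; exact decide_eq_false h0
  have hb3 : Nat.beq n 1 = false := by rw [natBeq_eq_decide]; exact decide_eq_false hn
  show sawStepG n (sawCodeG n) j m c l1 V L = _
  simp only [sawStepG, memG_eq, h, hb1, hb2, hb3, cond_false]
  show stepLoopG (sawCodeG n) j m c l1 (nextV c V) (c :: L) (Nat.ble (2 * j + l1 + 2) (n + 1)) m c 1 0 +
      freshTermG (sawCodeG n) j m c l1 (nextV c V) (c :: L) = _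
  rw [stepLoopG_eq, zero_add]
  congr 1
  · refine sum_congr rfl fun i _ => ?_
    rw [one_mul]
    show plusTermG (sawCodeG n) j m c l1 (nextV c V) (c :: L) _ (digitAt c i) (sawB ^ i) +
        minusTermG (sawCodeG n) j m c l1 (nextV c V) (c :: L) _ (digitAt c i) (sawB ^ i) = _
    simp only [plusTermG, minusTermG, natBlt_eq_decide, natBle_eq_decide, ← Bool.decide_or, Bool.cond_decide]
    congr 1
    · show (if 2 * j + l1 + 2 ≤ n + 1 ∨ digitAt c i < 32 then
          sawCodeG n j m (c + sawB ^ i) (if 32 ≤ digitAt c i then l1 + 1 else l1 - 1) (nextV c V) (c :: L) else 0) = _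
      by_cases hg : 2 * j + l1 + 2 ≤ n + 1 ∨ digitAt c i < 32
      · rw [if_pos hg]; rfl
      · rw [if_neg hg, not_or] at *
        show 0 = sawCodeG n j m (c + sawB ^ i) (if 32 ≤ digitAt c i then l1 + 1 else l1 - 1) (nextV c V) (c :: L)
        rw [if_pos (by omega), sawCodeG_prune (by omega)]
    · show (if 2 * j + l1 + 2 ≤ n + 1 ∨ 32 < digitAt c i then
          sawCodeG n j m (c - sawB ^ i) (if digitAt c i ≤ 32 then l1 + 1 else l1 - 1) (nextV c V) (c :: L) else 0) = _
      by_cases hg : 2 * j + l1 + 2 ≤ n + 1 ∨ 32 < digitAt c i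
      · rw [if_pos hg]; rfl
      · rw [if_neg hg, not_or] at *
        show 0 = sawCodeG n j m (c - sawB ^ i) (if digitAt c i ≤ 32 then l1 + 1 else l1 - 1) (nextV c V) (c :: L)
        rw [if_pos (by omega), sawCodeG_prune (by omega)]
  · simp only [freshTermG, natBeq_eq_decide, Bool.cond_decide]
    rfl

/-- **The two-step leaf** (`2` steps left, node alive): at `‖y‖₁ = 2` the number of inward neighbours not yet
visited, else `0`. [folklore] -/
theorem sawCodeG_two_of_open {j m c l1 V : ℕ} {L : List ℕ} (h : memF c V L = false)
    (hp : ¬ 2 < 2 * j + l1) (h0 : l1 ≠ 0) :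
    sawCodeG 2 j m c l1 V L =
      if l1 = 2 then
        ∑ i ∈ range m,
          ((if digitAt c i < sawR then (bif memF (c + sawB ^ i) (nextV c V) (c :: L) then 0 else 1) else 0) +
            (if sawR < digitAt c i then (bif memF (c - sawB ^ i) (nextV c V) (c :: L) then 0 else 1) else 0))
      else 0 := by
  have hb1 : Nat.blt (Nat.add 1 1) (Nat.add (Nat.mul 2 j) l1) = false := by
    rw [natBlt_eq_decide]; exact decide_eq_false (by show ¬ 1 + 1 < 2 * j + l1; omega)
  have hb2 : Nat.beq l1 0 = false := by rw [natBeq_eq_decide]; exact decide_eq_false h0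
  show sawStepG 1 (sawCodeG 1) j m c l1 V L = _
  simp only [sawStepG, memG_eq, h, hb1, hb2, cond_false, show Nat.beq 1 1 = true from rfl, cond_true,
    natBeq_eq_decide, Bool.cond_decide]
  split_ifs with h2
  · show leafLoopG c (nextV c V) (c :: L) m c 1 0 = _
    rw [leafLoopG_eq, zero_add]
    refine sum_congr rfl fun i _ => ?_
    rw [one_mul]
    show leafTermG c (nextV c V) (c :: L) (digitAt c i) (sawB ^ i) = _
    simp only [leafTermG, memG_eq, natBlt_eq_decide, Bool.cond_decide]
    rfl
  · rfl

/-! ### Lattice-side lemmas for the closed-form leaf -/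

/-- The walk never returns to a visited origin: `sawCount d n z B = 0` if `0 ∈ B`. [folklore] -/
theorem sawCount_eq_zero_of_zero_mem (n : ℕ) :
    ∀ (z : Site d) (B : Finset (Site d)), (0 : Site d) ∈ B → sawCount d n z B = 0 := by
  induction n with
  | zero =>
    intro z B h0
    by_cases hz : z ∈ B
    · exact sawCount_of_mem hz
    · rw [sawCount_zero_of_not_mem hz, if_neg]
      rintro rfl
      exact hz h0
  | succ n ih =>
    intro z B h0
    by_cases hz : z ∈ B
    · exact sawCount_of_mem hz
    · rw [sawCount_succ_of_not_mem n hz]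
      exact sum_eq_zero fun a _ => ih _ _ (mem_insert_of_mem h0)

/-- `‖z‖₁` summed over the active coordinates only. [folklore] -/
theorem l1Norm_eq_sum_range {m : ℕ} (hm : m ≤ d) {z : Site d} (hz : SuppBelow m z) :
    l1Norm z = ∑ i ∈ range m, (coordAt z i).natAbs := by
  unfold l1Norm
  have h2 : ∑ i ∈ Ico m d, (coordAt z i).natAbs = 0 := by
    refine sum_eq_zero fun i hi => ?_
    rw [mem_Ico] at hi
    rw [coordAt_of_lt z hi.2, hz ⟨i, hi.2⟩ hi.1]
    rfl
  rw [← add_zero (∑ i ∈ range m, (coordAt z i).natAbs), ← h2, sum_range_add_sum_Ico _ hm, Finset.sum_range]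
  exact Fintype.sum_congr _ _ fun k => by rw [coordAt_of_lt z k.isLt]

/-- Coded membership is membership (injectivity of the code on box points). [folklore] -/
theorem memL_code_iff {D m : ℕ} {z : Site d} {A : Finset (Site d)} {L : List ℕ} (hmD : m ≤ D)
    (hz : SuppBelow m z) (hzbox : InBox z) (hA : ∀ w ∈ A, SuppBelow m w) (hAbox : ∀ w ∈ A, InBox w)
    (hL : ∀ c, memL c L = true ↔ c ∈ A.image (code D)) : memL (code D z) L = true ↔ z ∈ A := by
  rw [hL, mem_image]
  constructor
  · rintro ⟨w, hw, hwz⟩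
    exact code_inj (hAbox w hw) hzbox ((hA w hw).mono hmD) (hz.mono hmD) hwz ▸ hw
  · exact fun h => ⟨z, h, rfl⟩

/-- **One step left** (lattice side of the closed-form leaf): from `z ≠ 0`, off a set `B ∌ 0`, the number of
one-step self-avoiding completions to the origin is `[z ∉ B] · [‖z‖₁ = 1]`. [folklore] -/
theorem sawCount_one_eq {m : ℕ} (hm : m ≤ d) {z : Site d} {B : Finset (Site d)} (hz : SuppBelow m z)
    (hB : ∀ w ∈ B, SuppBelow m w) (hzbox : InBox z) (h0B : (0 : Site d) ∉ B) (hz0 : z ≠ 0) :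
    sawCount d 1 z B = if z ∉ B ∧ l1Norm z = 1 then 1 else 0 := by
  by_cases hzB : z ∈ B
  · rw [sawCount_of_mem hzB, if_neg (fun h => h.1 hzB)]
  rw [sawCount_succ_of_suppBelow hm 0 hz hB hzB]
  simp only [hzB, not_false_eq_true, true_and]
  have h0B' : (0 : Site d) ∉ insert z B := by
    rw [mem_insert, not_or]
    exact ⟨fun h => hz0 h.symm, h0B⟩
  have hval : ∀ w : Site d, sawCount d 0 w (insert z B) = if l1Norm w = 0 then 1 else 0 := by
    intro w
    by_cases hw : w ∈ insert z B
    · rw [sawCount_of_mem hw, if_neg]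
      intro h
      rw [l1Norm_eq_zero_iff] at h
      exact h0B' (h ▸ hw)
    · rw [sawCount_zero_of_not_mem hw]
      simp only [l1Norm_eq_zero_iff]
  simp_rw [hval]
  have hfresh : 2 * (d - m) * (if l1Norm (z + bvec d m) = 0 then 1 else 0) = 0 := by
    by_cases hmd : m < d
    · rw [l1Norm_add_bvec_fresh hz hmd, if_neg (by omega), mul_zero]
    · rw [show d - m = 0 by omega, mul_zero, zero_mul]
  rw [hfresh, add_zero]
  have hL : l1Norm z ≠ 0 := fun h => hz0 ((l1Norm_eq_zero_iff z).1 h)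
  by_cases h1 : l1Norm z = 1
  · rw [if_pos h1]
    have hterm : ∀ i ∈ range m,
        ((if l1Norm (z + bvec d i) = 0 then 1 else 0) + (if l1Norm (z - bvec d i) = 0 then 1 else 0) : ℕ) =
          (coordAt z i).natAbs := by
      intro i hi
      rw [mem_range] at hi
      have hid : i < d := by omega
      have hle : (coordAt z i).natAbs ≤ 1 := by
        rw [← h1, l1Norm_eq_sum_range hm hz]
        exact single_le_sum (f := fun i => (coordAt z i).natAbs) (fun _ _ => Nat.zero_le _) (mem_range.2 hi)
      rw [l1Norm_add_bvec hzbox hi hid, l1Norm_sub_bvec hzbox hi hid, digitAt_code hzbox hi, h1]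
      have hc := natAbs_coordAt_lt hzbox i
      have hd : (digitOf z i : ℤ) = coordAt z i + 32 := by
        simp only [digitOf, sawR] at hc ⊢
        omega
      have hR : sawR = 32 := rfl
      generalize hu : (if sawR ≤ digitOf z i then 1 + 1 else 1 - 1) = u
      generalize hv : (if digitOf z i ≤ sawR then 1 + 1 else 1 - 1) = v
      split_ifs at hu hv <;> split_ifs <;> omega
    rw [sum_congr rfl hterm, ← l1Norm_eq_sum_range hm hz, h1]
  · rw [if_neg h1]
    refine sum_eq_zero fun i hi => ?_
    rw [mem_range] at hi
    have hid : i < d := by omega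
    rw [l1Norm_add_bvec hzbox hi hid, l1Norm_sub_bvec hzbox hi hid]
    generalize hu : (if sawR ≤ digitAt (code m z) i then l1Norm z + 1 else l1Norm z - 1) = u
    generalize hv : (if digitAt (code m z) i ≤ sawR then l1Norm z + 1 else l1Norm z - 1) = v
    split_ifs at hu hv <;> split_ifs <;> omega

/-! ### The transfer theorem -/

/-- **Transfer**: the kernel recursion `sawCodeG` computes `sawCount`, uniformly in `d`.  For `y`, `A ∌ 0`
supported on the first `m ≤ d` coordinates, inside the box with margin `n`, `L` listing the codes of `A` and
`V` its residue filter: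
`sawCount d n y A = Σ_{j ≤ n} sawCodeG n j m (code D y) ‖y‖₁ V L · 2^j (d-m)^{(j)}`. [folklore] -/
theorem sawCount_eq_sum_sawCodeG (D : ℕ) (n : ℕ) :
    ∀ (m : ℕ) (y : Site d) (A : Finset (Site d)) (V : ℕ) (L : List ℕ),
      m ≤ d → SuppBelow m y → (∀ z ∈ A, SuppBelow m z) → m + n ≤ D →
      (∀ i : Fin d, (y i).natAbs + n < sawR) → (∀ z ∈ A, InBox z) → (0 : Site d) ∉ A → FInv V L →
      (∀ c, memL c L = true ↔ c ∈ A.image (code D)) →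
      sawCount d n y A = ∑ j ∈ range (n + 1), sawCodeG n j m (code D y) (l1Norm y) V L * freshWeight d m j := by
  induction n with
  | zero =>
    intro m y A V L hmd hy hA hmD hbox hAbox h0A hV hL
    have hyBox : InBox y := fun i => by have := hbox i; omega
    rw [sum_range_one, freshWeight_zero, mul_one]
    by_cases hyA : y ∈ A
    · rw [sawCount_of_mem hyA, sawCodeG_of_memF]
      rw [memF_eq hV]
      exact (memL_code_iff hmD hy hyBox hA hAbox hL).2 hyA
    · have hc : memF (code D y) V L = false := by
        rw [memF_eq hV, Bool.eq_false_iff, ne_eq, memL_code_iff hmD hy hyBox hA hAbox hL]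
        exact hyA
      rw [sawCount_zero_of_not_mem hyA, sawCodeG_zero_of_not_memF hc, zero_add]
      simp only [l1Norm_eq_zero_iff]
  | succ n ih =>
    intro m y A V L hmd hy hA hmD hbox hAbox h0A hV hL
    have hyBox : InBox y := fun i => by have := hbox i; omega
    have hmD' : m < D := by omega
    by_cases hyA : y ∈ A
    · rw [sawCount_of_mem hyA]
      symm
      refine sum_eq_zero fun j _ => ?_
      rw [sawCodeG_of_memF, zero_mul]
      rw [memF_eq hV]
      exact (memL_code_iff (by omega) hy hyBox hA hAbox hL).2 hyA
    have hc : memF (code D y) V L = false := by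
      rw [memF_eq hV, Bool.eq_false_iff, ne_eq, memL_code_iff (by omega) hy hyBox hA hAbox hL]
      exact hyA
    -- at the origin: no self-avoiding continuation of positive length
    by_cases hy0 : y = 0
    · subst hy0
      rw [sawCount_succ_of_not_mem n hyA]
      rw [sum_eq_zero fun a _ => sawCount_eq_zero_of_zero_mem n _ _ (mem_insert_self _ _)]
      symm
      refine sum_eq_zero fun j _ => ?_
      rw [show l1Norm (0 : Site d) = 0 from (l1Norm_eq_zero_iff _).2 rfl, sawCodeG_succ_origin, zero_mul]
    have hl1 : l1Norm y ≠ 0 := fun h => hy0 ((l1Norm_eq_zero_iff y).1 h)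
    -- data of the children
    set A' := insert y A with hA'def
    set L' := code D y :: L with hL'def
    set V' := nextV (code D y) V with hV'def
    have hA' : ∀ z ∈ A', SuppBelow m z := by
      intro z hz
      rcases mem_insert.1 hz with rfl | hz
      exacts [hy, hA z hz]
    have hA'box : ∀ z ∈ A', InBox z := by
      intro z hz
      rcases mem_insert.1 hz with rfl | hz
      exacts [hyBox, hAbox z hz]
    have h0A' : (0 : Site d) ∉ A' := by
      rw [hA'def, mem_insert, not_or]
      exact ⟨fun h => hy0 h.symm, h0A⟩
    have hV' : FInv V' L' := hV.cons (code D y)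
    have hL' : ∀ c, memL c L' = true ↔ c ∈ A'.image (code D) := by
      intro c
      rw [hL'def, hA'def, image_insert, mem_insert, memL, Bool.or_eq_true, Nat.beq_eq, hL]
    -- the closed-form leaf: two steps left
    by_cases hn1 : n = 1
    · subst hn1
      have hRHS : ∀ j ∈ range (1 + 1 + 1),
          sawCodeG (1 + 1) j m (code D y) (l1Norm y) V L * freshWeight d m j =
            if j = 0 then sawCodeG 2 0 m (code D y) (l1Norm y) V L else 0 := by
        intro j _
        split_ifs with hj
        · subst hj; rw [freshWeight_zero, mul_one]
        · rw [sawCodeG_prune (by omega), zero_mul]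
      rw [sum_congr rfl hRHS, sum_ite_eq' (range (1 + 1 + 1)) 0, if_pos (by simp)]
      rcases Nat.lt_or_ge 2 (l1Norm y) with h3 | h3
      · -- too far from the origin
        rw [sawCodeG_prune (by omega)]
        exact sawCount_eq_zero_of_lt _ _ _ h3
      by_cases h2 : l1Norm y = 2
      swap
      · -- `‖y‖₁ = 1`: wrong parity
        rw [sawCodeG_two_of_open hc (by omega) hl1, if_neg h2]
        exact sawCount_eq_zero_of_odd _ _ _ (by omega)
      rw [sawCodeG_two_of_open hc (by omega) hl1, if_pos h2, sawCount_succ_of_suppBelow hmd 1 hy hA hyA]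
      have hbox1 : ∀ i : Fin d, (y i).natAbs + 1 < sawR := fun i => by have := hbox i; omega
      -- coded membership of a child
      have hmem : ∀ (z : Site d) (cz : ℕ), SuppBelow m z → InBox z → code D z = cz →
          memF cz V' L' = decide (z ∈ A') := by
        intro z cz hz hzb hcz
        subst hcz
        rw [memF_eq hV']
        exact Bool.eq_iff_iff.2 (by rw [decide_eq_true_iff]; exact memL_code_iff (le_of_lt hmD') hz hzb hA' hA'box hL')
      have hfresh : 2 * (d - m) * sawCount d 1 (y + bvec d m) A' = 0 := by
        by_cases hmd2 : m < d
        · have hne : y + bvec d m ≠ 0 := fun h => by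
            have := l1Norm_add_bvec_fresh hy hmd2
            rw [h, (l1Norm_eq_zero_iff _).2 rfl] at this
            omega
          rw [sawCount_one_eq (m := m + 1) hmd2 hy.add_bvec_succ (fun z hz => (hA' z hz).mono (Nat.le_succ m))
              (inBox_add_bvec hbox1 m) h0A' hne,
            l1Norm_add_bvec_fresh hy hmd2, if_neg (fun h => absurd h.2 (by omega)), mul_zero]
        · rw [show d - m = 0 by omega, mul_zero, zero_mul]
      rw [hfresh, add_zero]
      refine sum_congr rfl fun i hi => ?_
      rw [mem_range] at hi
      have hid : i < d := by omega
      have hiD : i < D := by omega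
      have hne1 : y + bvec d i ≠ 0 := fun h => by
        have := l1Norm_add_bvec hyBox hiD hid
        rw [h, (l1Norm_eq_zero_iff _).2 rfl] at this
        split_ifs at this
        all_goals omega
      have hne2 : y - bvec d i ≠ 0 := fun h => by
        have := l1Norm_sub_bvec hyBox hiD hid
        rw [h, (l1Norm_eq_zero_iff _).2 rfl] at this
        split_ifs at this
        all_goals omega
      rw [sawCount_one_eq hmd (hy.add_bvec hi) hA' (inBox_add_bvec hbox1 i) h0A' hne1,
        sawCount_one_eq hmd (hy.sub_bvec hi) hA' (inBox_sub_bvec hbox1 i) h0A' hne2,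
        l1Norm_add_bvec hyBox hiD hid, l1Norm_sub_bvec hyBox hiD hid,
        hmem _ _ (hy.add_bvec hi) (inBox_add_bvec hbox1 i) (code_add_bvec hyBox hiD hid),
        hmem _ _ (hy.sub_bvec hi) (inBox_sub_bvec hbox1 i) (code_sub_bvec hyBox hiD hid), h2]
      congr 1
      · by_cases hg : sawR ≤ digitAt (code D y) i
        · rw [if_pos hg, if_neg (not_lt.2 hg), if_neg (fun h => absurd h.2 (by omega))]
        · rw [if_neg hg, if_pos (not_le.1 hg)]
          by_cases hz : y + bvec d i ∈ A'
          · rw [decide_eq_true hz, cond_true, if_neg (fun h => h.1 hz)]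
          · rw [decide_eq_false hz, cond_false, if_pos ⟨hz, by omega⟩]
      · by_cases hg : digitAt (code D y) i ≤ sawR
        · rw [if_pos hg, if_neg (not_lt.2 hg), if_neg (fun h => absurd h.2 (by omega))]
        · rw [if_neg hg, if_pos (not_le.1 hg)]
          by_cases hz : y - bvec d i ∈ A'
          · rw [decide_eq_true hz, cond_true, if_neg (fun h => h.1 hz)]
          · rw [decide_eq_false hz, cond_false, if_pos ⟨hz, by omega⟩]
    -- the generic step: the semantic children
    let p : ℕ → ℕ → ℕ := fun i j =>
      sawCodeG n j m (code D (y + bvec d i)) (l1Norm (y + bvec d i)) V' L'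
    let q : ℕ → ℕ → ℕ := fun i j =>
      sawCodeG n j m (code D (y - bvec d i)) (l1Norm (y - bvec d i)) V' L'
    let f : ℕ → ℕ := fun j => sawCodeG n j (m + 1) (code D y + sawB ^ m) (l1Norm y + 1) V' L'
    -- IH for the active children
    have hP : ∀ i ∈ range m,
        sawCount d n (y + bvec d i) A' = ∑ j ∈ range (n + 1), p i j * freshWeight d m j := by
      intro i hi
      rw [mem_range] at hi
      exact ih m _ A' V' L' hmd (hy.add_bvec hi) hA' (by omega) (margin_add_bvec hbox i) hA'box h0A' hV' hL'
    have hQ : ∀ i ∈ range m,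
        sawCount d n (y - bvec d i) A' = ∑ j ∈ range (n + 1), q i j * freshWeight d m j := by
      intro i hi
      rw [mem_range] at hi
      exact ih m _ A' V' L' hmd (hy.sub_bvec hi) hA' (by omega) (margin_sub_bvec hbox i) hA'box h0A' hV' hL'
    -- the key identity per `j`
    have key : ∀ j, sawCodeG (n + 1) j m (code D y) (l1Norm y) V L =
        (∑ i ∈ range m, (p i j + q i j)) + (if j = 0 then 0 else f (j - 1)) := by
      intro j
      by_cases hp : n + 1 < 2 * j + l1Norm y
      · rw [sawCodeG_prune hp]
        symm
        rw [Nat.add_eq_zero_iff]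
        refine ⟨sum_eq_zero fun i hi => ?_, ?_⟩
        · rw [mem_range] at hi
          have hid : i < d := by omega
          have h1 := l1Norm_sub_stepVec (y + bvec d i) (⟨i, hid⟩, true)
          have h2 := l1Norm_sub_stepVec (y - bvec d i) (⟨i, hid⟩, false)
          rw [stepVec_true] at h1
          rw [stepVec_false, sub_neg_eq_add] at h2
          have e1 : y + bvec d i - bvec d i = y := add_sub_cancel_right y _
          have e2 : y - bvec d i + bvec d i = y := sub_add_cancel y _
          simp only [e1, e2] at h1 h2
          show sawCodeG n j m _ _ V' L' + sawCodeG n j m _ _ V' L' = 0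
          rw [sawCodeG_prune (by omega), sawCodeG_prune (by omega)]
        · split_ifs with hj
          · rfl
          · exact sawCodeG_prune (by omega)
      · rw [sawCodeG_succ_of_open n hn1 hc hp hl1]
        congr 1
        refine sum_congr rfl fun i hi => ?_
        rw [mem_range] at hi
        have hid : i < d := by omega
        have hiD : i < D := by omega
        show _ = sawCodeG n j m _ _ V' L' + sawCodeG n j m _ _ V' L'
        rw [code_add_bvec hyBox hiD hid, code_sub_bvec hyBox hiD hid, l1Norm_add_bvec hyBox hiD hid,
          l1Norm_sub_bvec hyBox hiD hid]
    -- assemble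
    rw [sawCount_succ_of_suppBelow hmd n hy hA hyA]
    have hR : ∑ j ∈ range (n + 1 + 1), sawCodeG (n + 1) j m (code D y) (l1Norm y) V L * freshWeight d m j =
        (∑ j ∈ range (n + 1 + 1), (∑ i ∈ range m, (p i j + q i j)) * freshWeight d m j) +
          ∑ j ∈ range (n + 1 + 1), (if j = 0 then 0 else f (j - 1)) * freshWeight d m j := by
      rw [← sum_add_distrib]
      exact sum_congr rfl fun j _ => by rw [key, add_mul]
    rw [hR]
    congr 1
    · -- active coordinates
      have hlast : (∑ i ∈ range m, (p i (n + 1) + q i (n + 1))) * freshWeight d m (n + 1) = 0 := by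
        rw [sum_eq_zero, zero_mul]
        intro i _
        show sawCodeG n (n + 1) m _ _ V' L' + sawCodeG n (n + 1) m _ _ V' L' = 0
        rw [sawCodeG_prune (by omega), sawCodeG_prune (by omega)]
      rw [sum_range_succ, hlast, add_zero,
        sum_congr rfl fun i hi => congrArg₂ (· + ·) (hP i hi) (hQ i hi)]
      simp_rw [sum_mul]
      rw [sum_comm (s := range (n + 1))]
      refine sum_congr rfl fun i _ => ?_
      rw [← sum_add_distrib]
      refine sum_congr rfl fun j _ => ?_
      ring
    · -- the fresh coordinate
      have hY : ∑ j ∈ range (n + 1 + 1), (if j = 0 then 0 else f (j - 1)) * freshWeight d m j =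
          ∑ j ∈ range (n + 1), f j * freshWeight d m (j + 1) := by
        rw [sum_range_succ']
        simp
      rw [hY]
      simp_rw [← freshWeight_succ d m]
      by_cases hmd2 : m < d
      · rw [ih (m + 1) _ A' V' L' hmd2 hy.add_bvec_succ (fun z hz => (hA' z hz).mono (Nat.le_succ m))
            (by omega) (margin_add_bvec hbox m) hA'box h0A' hV' hL', code_add_bvec hyBox hmD' hmd2,
          l1Norm_add_bvec_fresh hy hmd2, mul_sum]
        refine sum_congr rfl fun j _ => ?_
        ring
      · have h0 : d - m = 0 := by omega
        simp [h0]

/-- **The SAW counts are polynomials in `d`, coefficientwise kernel-evaluable by `sawCodeG`.**  For `x`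
supported on the first `s ≤ d` coordinates with `|x_i| + n < 32`:
`#sawWordsTo d n x = Σ_{j ≤ n} sawCodeG n j s (code (s + n) x) ‖x‖₁ 0 [] · 2^j (d - s)^{(j)}`. [folklore] -/
theorem card_sawWordsTo_eq_sum_sawCodeG (n s : ℕ) (hsd : s ≤ d) (x : Site d) (hx : SuppBelow s x)
    (hbox : ∀ i : Fin d, (x i).natAbs + n < sawR) :
    (sawWordsTo d n x).card =
      ∑ j ∈ range (n + 1), sawCodeG n j s (code (s + n) x) (l1Norm x) 0 [] * freshWeight d s j := by
  rw [card_sawWordsTo_eq_sawCount]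
  exact sawCount_eq_sum_sawCodeG (s + n) n s x ∅ 0 [] hsd hx (by simp) le_rfl hbox (by simp) (by simp) fInv_nil
    (fun c => by simp [memL])

/-- **Generic table lemma for `sawCodeG`** (cf. `card_sawWordsTo_siteOfList`). For an end-point given by its
coordinate list `l` (`|l| = s ≤ d`, entries `|l_i| + n < 32`):
`#sawWordsTo d n x = Σ_{j ≤ n} sawCodeG n j s C L1 0 [] · 2^j (d - s)^{(j)}` with the closed numerals
`C = codeList l (s + n)`, `L1 = Σ|l_i|`. [folklore] -/
theorem card_sawWordsTo_siteOfList_G {l : List ℤ} {n s C L1 : ℕ} (hs : l.length = s) (hsd : s ≤ d)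
    (hC : codeList l (s + n) = C) (hL1 : (l.map Int.natAbs).sum = L1)
    (hbox : ∀ a ∈ l, a.natAbs + n < sawR) (hn : n < sawR) :
    (sawWordsTo d n (siteOfList l d)).card =
      ∑ j ∈ range (n + 1), sawCodeG n j s C L1 0 [] * freshWeight d s j := by
  subst hs; subst hC; subst hL1
  rw [card_sawWordsTo_eq_sum_sawCodeG n l.length hsd _ (suppBelow_siteOfList l d) (margin_siteOfList hbox hn),
    code_siteOfList hsd, l1Norm_siteOfList hsd]

/-! ### One-step expansion of `sawCodeG` (bookkeeping for split kernel evaluations)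

All children are stated over the PARENT's arguments (cf. `SawCountTables.plusChild`), so that no intermediate
numeral is written down. -/

/-- Is the node alive (not pruned, not visited, not at the origin)? [folklore] -/
def gOpen (n j c l1 V : ℕ) (L : List ℕ) : Bool :=
  !(Nat.blt (n + 1) (2 * j + l1) || memF c V L || Nat.beq l1 0)

/-- The `+e_i` summand of `sawStepG`. [folklore] -/
noncomputable def gPlus (n j m c l1 V : ℕ) (L : List ℕ) (i : ℕ) : ℕ :=
  bif plusGuard n j c l1 i then sawCodeG n j m (plusCode c i) (plusL1 c l1 i) (nextV c V) (c :: L) else 0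

/-- The `-e_i` summand of `sawStepG`. [folklore] -/
noncomputable def gMinus (n j m c l1 V : ℕ) (L : List ℕ) (i : ℕ) : ℕ :=
  bif minusGuard n j c l1 i then sawCodeG n j m (minusCode c i) (minusL1 c l1 i) (nextV c V) (c :: L) else 0

/-- The fresh-coordinate summand of `sawStepG`. [folklore] -/
noncomputable def gFresh (n j m c l1 V : ℕ) (L : List ℕ) : ℕ :=
  match j with
  | 0 => 0
  | j' + 1 => sawCodeG n j' (m + 1) (plusCode c m) (l1 + 1) (nextV c V) (c :: L)

/-- **One-step expansion** (`n ≠ 1`): `sawCodeG (n+1)` as the guarded sum of its children. [folklore] -/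
theorem sawCodeG_succ_expand (n j m c l1 V : ℕ) (L : List ℕ) (hn : n ≠ 1) :
    sawCodeG (n + 1) j m c l1 V L =
      bif gOpen n j c l1 V L then
        stepSum m (fun i => gPlus n j m c l1 V L i + gMinus n j m c l1 V L i) + gFresh n j m c l1 V L
      else 0 := by
  unfold gOpen
  cases hb : Nat.blt (n + 1) (2 * j + l1)
  · cases hm : memF c V L
    · cases h0 : Nat.beq l1 0
      · have hp : ¬ n + 1 < 2 * j + l1 := by simpa [natBlt_eq_decide] using hb
        have hl : l1 ≠ 0 := by simpa [natBeq_eq_decide] using h0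
        rw [sawCodeG_succ_of_open n hn hm hp hl, stepSum_eq_sum]
        show _ = (∑ i ∈ range m, (gPlus n j m c l1 V L i + gMinus n j m c l1 V L i)) + gFresh n j m c l1 V L
        congr 1
        · refine sum_congr rfl fun i _ => ?_
          simp only [gPlus, gMinus, plusGuard, minusGuard, plusCode, minusCode, plusL1, minusL1,
            natBlt_eq_decide, natBle_eq_decide, ← Bool.decide_or, Bool.cond_decide]
          congr 1
          · by_cases hg : 2 * j + l1 + 2 ≤ n + 1 ∨ digitAt c i < sawR
            · rw [if_pos hg]
            · rw [if_neg hg, sawCodeG_prune]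
              rw [not_or] at hg
              rw [if_pos (by omega)]
              omega
          · by_cases hg : 2 * j + l1 + 2 ≤ n + 1 ∨ sawR < digitAt c i
            · rw [if_pos hg]
            · rw [if_neg hg, sawCodeG_prune]
              rw [not_or] at hg
              rw [if_pos (by omega)]
              omega
        · cases j <;> rfl
      · have hl : l1 = 0 := by simpa [natBeq_eq_decide] using h0
        subst hl
        rw [sawCodeG_succ_origin]
        rfl
    · rw [sawCodeG_of_memF hm]
      rfl
  · have hp : n + 1 < 2 * j + l1 := by simpa [natBlt_eq_decide] using hb
    rw [sawCodeG_prune hp]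
    rfl

/-- A spawned `+e_i` child is the plain recursive call. [folklore] -/
theorem gPlus_of_guard {n j c l1 i : ℕ} (h : plusGuard n j c l1 i = true) (m V : ℕ) (L : List ℕ) :
    gPlus n j m c l1 V L i = sawCodeG n j m (plusCode c i) (plusL1 c l1 i) (nextV c V) (c :: L) := by
  simp [gPlus, h]

/-- A spawned `-e_i` child is the plain recursive call. [folklore] -/
theorem gMinus_of_guard {n j c l1 i : ℕ} (h : minusGuard n j c l1 i = true) (m V : ℕ) (L : List ℕ) :
    gMinus n j m c l1 V L i = sawCodeG n j m (minusCode c i) (minusL1 c l1 i) (nextV c V) (c :: L) := by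
  simp [gMinus, h]

/-- The fresh child for `j = j' + 1`. [folklore] -/
theorem gFresh_succ (n j' m c l1 V : ℕ) (L : List ℕ) :
    gFresh n (j' + 1) m c l1 V L = sawCodeG n j' (m + 1) (plusCode c m) (l1 + 1) (nextV c V) (c :: L) :=
  rfl

end Literature.Probability.FitznerVanDerHofstad2017
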